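import Summits.KontsevichZagierPeriods.KontsevichZagierPeriods.Theorems.UnfoldedStokesStokesGenerationStubGermToOanAuxEval
import Summits.KontsevichZagierPeriods.KontsevichZagierPeriods.Theorems.UnfoldedStokesStokesGenerationStubGermToOanAuxSeries
import Literature.NumberTheory.Transcendental.SemialgebraicMapsSmoothProofs
import Literature.NumberTheory.Transcendental.KZCalculus
import Mathlib.FieldTheory.AlgebraicClosure
import Mathlib.Analysis.Normed.Group.FunctionSeries
import Mathlib.Topology.Order.DenselyOrdered

/-!
# `StokesGeneration` (stmt-KontsevichZagierPeriods-3586), line `Sketch`: stub `stub_germToOan`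

The ANALYTIC HALF OF THE DICTIONARY between germ cube representations of the Kontsevich–Zagier calculus
and Ayoub's algebra `𝒪_{ℚ̄-alg}(𝔻̄^∞)` (J. Ayoub, EMS Newsl. 91 (2014), §2.2, Def. 9, Rem. 13;
Ann. of Math. 181 (2015), §1.1), typed over `Literature/NumberTheory/Transcendental/AyoubPeriodSeries.lean`.
If `h : ℝᴺ → ℝ` is `ℚ`-semialgebraic on an open `V ⊇ [0,1]ᴺ` and equals on the closed cube the sum of a
real power series `Σₐ cₐ xᵃ` with `Σₐ |cₐ| R^{|a|} < ∞`, `R > 1`, then the complex series `F` with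
`coeff (a pushed along Fin N ↪ ℕ) F = cₐ` and all other coefficients `0` lies in `𝒪_{ℚ̄-alg}(𝔻̄^∞)`
(`ℚ̄ = algebraicClosure ℚ ℂ ↪ ℂ`) and `∫_{[0,1]^∞} F = ∫_{[0,1]ᴺ} h`.

Proof. `F` (part 3, `…StubGermToOanAuxSeries`) depends only on `z₀, …, z_{N-1}` and has polyradius
`R`. ALGEBRAICITY: the graph of a semialgebraic function lies in a proper algebraic hypersurface
(tree: `IsSemialgebraicFunOn.exists_finset_forall_exists_aeval_cons_eq_zero`, Bochnak–Coste–Roy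
1998, §2.9), i.e. `Σᵢ qᵢ(x) h(x)ⁱ = 0` on `V` with `(qᵢ) ≠ 0` (`exists_polynomial_identity`); the
formal composite `G = Σᵢ qᵢ Fⁱ ∈ ℂ[[z]]` has absolutely summable coefficients and vanishes at every
point of the closed cube (evaluation is a ring homomorphism: part 2, `…StubGermToOanAuxEval`), hence
`G = 0` by the identity theorem on the cube (below). INTEGRAL (part 3): termwise integration,
`∫_{[0,1]ᴺ} xᵃ = ∏ⱼ (aⱼ+1)⁻¹`. No definition is introduced.
-/

noncomputable section

-- `Summit.KontsevichZagierPeriods.KontsevichZagierPeriods.…` is the tree's mandated layout (single-conjunct summit).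
set_option linter.dupNamespace false

namespace Summit.KontsevichZagierPeriods.KontsevichZagierPeriods.StokesGenerationLine

open MeasureTheory Set
open Literature.NumberTheory.Transcendental
open Literature.NumberTheory.Transcendental.KZ

/-! ## The polynomial identity of a semialgebraic function -/

/-- Complexification of the value of a rational polynomial at a real point. [folklore] -/
theorem ofReal_aeval_eq {N : ℕ} (x : Fin N → ℝ) (p : MvPolynomial (Fin N) ℚ) :
    ((MvPolynomial.aeval x p : ℝ) : ℂ) =
      MvPolynomial.eval₂ (algebraMap ℚ ℂ) (fun j => ((x j : ℝ) : ℂ)) p := by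
  induction p using MvPolynomial.induction_on with
  | C a => simp
  | add p q hp hq => simp [hp, hq]
  | mul_X p i hp => simp [hp]

/-- **A `ℚ`-semialgebraic function satisfies a non-trivial polynomial identity**
`Σᵢ qᵢ(x) h(x)ⁱ = 0` on its domain, `qᵢ ∈ ℚ[x₁, …, x_N]` not all zero: the graph lies in a proper
algebraic hypersurface `Q(y, x) = 0` (`IsSemialgebraicFunOn.exists_finset_forall_exists_aeval_cons_eq_zero`,
product of the finitely many polynomials), rewritten in `ℚ[x][y]` by `MvPolynomial.finSuccEquiv`.
[cite: BochnakCosteRoy1998, Prop. 2.9.10 (proof)] -/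
theorem exists_polynomial_identity {N : ℕ} {V : Set (Fin N → ℝ)} {h : (Fin N → ℝ) → ℝ}
    (hh : IsSemialgebraicFunOn ℚ V h) :
    ∃ Q₁ : Polynomial (MvPolynomial (Fin N) ℚ), Q₁ ≠ 0 ∧
      ∀ x ∈ V, ∑ i ∈ Finset.range (Q₁.natDegree + 1),
        MvPolynomial.aeval x (Q₁.coeff i) * h x ^ i = 0 := by
  classical
  obtain ⟨Q₀, hQ₀, hvan⟩ := hh.exists_finset_forall_exists_aeval_cons_eq_zero
  set Q : MvPolynomial (Fin (N + 1)) ℚ := ∏ q ∈ Q₀, q with hQ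
  have hQne : Q ≠ 0 := Finset.prod_ne_zero_iff.2 fun q hq h0 => by
    obtain ⟨w, hw⟩ := hQ₀ q hq
    exact hw (by rw [h0, map_zero])
  have hQv : ∀ x ∈ V, MvPolynomial.aeval (Fin.cons (h x) x : Fin (N + 1) → ℝ) Q = 0 :=
    fun x hx => by
      obtain ⟨q, hq, hq0⟩ := hvan x hx
      rw [hQ, map_prod]
      exact Finset.prod_eq_zero hq hq0
  refine ⟨MvPolynomial.finSuccEquiv ℚ N Q, (EmbeddingLike.map_ne_zero_iff).2 hQne, fun x hx => ?_⟩
  have h2 := hQv x hx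
  rw [aeval_cons_eq_eval_map, Polynomial.eval_map, Polynomial.eval₂_eq_sum_range] at h2
  exact h2

/-! ## The identity theorem on the closed unit cube (= part 1, `…StubGermToOanAuxIdentity`,
repeated privately so that this file does not depend on that module) -/

/-- A real monomial at a point of the closed unit cube has modulus `≤ 1`. [folklore] -/
private theorem norm_prod_ofReal_pow_le_one_loc {N : ℕ} (x : Fin N → ℝ)
    (hx : ∀ j, x j ∈ Icc (0:ℝ) 1) (b : Fin N → ℕ) : ‖∏ j, ((x j : ℝ) : ℂ) ^ (b j)‖ ≤ 1 := by
  rw [norm_prod]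
  refine Finset.prod_le_one (fun j _ => norm_nonneg _) fun j _ => ?_
  rw [norm_pow, Complex.norm_real, Real.norm_of_nonneg (hx j).1]
  exact pow_le_one₀ (hx j).1 (hx j).2

/-- **Identity theorem on `[0,1]`, one variable**: `Σ_k ‖g k‖ < ∞` and `Σ_k g(k) tᵏ = 0` on `[0,1]`
force `g = 0` (shifted sums `S_m(t) = Σ_k g(k+m) tᵏ`: `S_m ≡ 0` on `(0,1]` ⇒ `g m = S_m(0) = 0`). [folklore] -/
private theorem eq_zero_of_tsum_mul_pow_eq_zero_loc (g : ℕ → ℂ) (hg : Summable fun k => ‖g k‖)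
    (h0 : ∀ t : ℝ, t ∈ Icc (0:ℝ) 1 → ∑' k, g k * (t : ℂ) ^ k = 0) : ∀ k, g k = 0 := by
  have hsum : ∀ m, Summable fun k => ‖g (k + m)‖ := fun m => (summable_nat_add_iff m).2 hg
  have hbd : ∀ m (t : ℝ), t ∈ Icc (0:ℝ) 1 → ∀ k, ‖g (k + m) * (t : ℂ) ^ k‖ ≤ ‖g (k + m)‖ := by
    intro m t ht k
    rw [norm_mul, norm_pow, Complex.norm_real, Real.norm_of_nonneg ht.1]
    exact mul_le_of_le_one_right (norm_nonneg _) (pow_le_one₀ ht.1 ht.2)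
  have hsumt : ∀ m (t : ℝ), t ∈ Icc (0:ℝ) 1 → Summable fun k => g (k + m) * (t : ℂ) ^ k :=
    fun m t ht => Summable.of_norm_bounded (hsum m) (hbd m t ht)
  have hcont : ∀ m, ContinuousOn (fun t : ℝ => ∑' k, g (k + m) * (t : ℂ) ^ k) (Icc 0 1) := by
    intro m
    refine continuousOn_tsum (fun k => ?_) (hsum m) fun k t ht => hbd m t ht k
    exact (continuous_const.mul (Complex.continuous_ofReal.pow k)).continuousOn
  -- vanishing on `(0,1]` forces the constant term to vanish (continuity at `0`)
  have hzero : ∀ m, (∀ t : ℝ, t ∈ Ioc (0:ℝ) 1 → ∑' k, g (k + m) * (t : ℂ) ^ k = 0) →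
      g m = 0 := by
    intro m hm
    have heq : EqOn (fun t : ℝ => ∑' k, g (k + m) * (t : ℂ) ^ k) (fun _ => (0 : ℂ)) (Icc 0 1) :=
      (show EqOn (fun t : ℝ => ∑' k, g (k + m) * (t : ℂ) ^ k) (fun _ => (0 : ℂ)) (Ioc 0 1) from
        fun t ht => hm t ht).of_subset_closure (hcont m) continuousOn_const
        Ioc_subset_Icc_self (by rw [closure_Ioc zero_ne_one])
    have h00 := heq (left_mem_Icc.2 zero_le_one)
    simp only [Complex.ofReal_zero] at h00
    rw [tsum_eq_single 0] at h00
    · simpa using h00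
    · intro k hk
      simp [zero_pow hk]
  -- induction on the shift
  have key : ∀ m, ∀ t : ℝ, t ∈ Ioc (0:ℝ) 1 → ∑' k, g (k + m) * (t : ℂ) ^ k = 0 := by
    intro m
    induction m with
    | zero =>
      intro t ht
      simpa using h0 t ⟨ht.1.le, ht.2⟩
    | succ m ih =>
      have hgm : g m = 0 := hzero m ih
      intro t ht
      have hsplit := (hsumt m t ⟨ht.1.le, ht.2⟩).tsum_eq_zero_add
      rw [ih t ht] at hsplit
      simp only [zero_add, pow_zero, mul_one, hgm] at hsplit
      have h2 : ∑' k, g (k + 1 + m) * (t : ℂ) ^ (k + 1) =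
          (t : ℂ) * ∑' k, g (k + (m + 1)) * (t : ℂ) ^ k := by
        rw [← tsum_mul_left]
        refine tsum_congr fun k => ?_
        rw [show k + 1 + m = k + (m + 1) by omega, pow_succ]
        ring
      rw [h2] at hsplit
      have ht0 : (t : ℂ) ≠ 0 := Complex.ofReal_ne_zero.2 ht.1.ne'
      simpa [ht0] using hsplit.symm
  exact fun k => hzero k (key k)

/-- **Identity theorem on the closed unit cube, `N` variables.** If `Σ_b ‖g b‖ < ∞`
(`b : Fin N → ℕ`) and `Σ_b g(b) ∏ⱼ xⱼ^{bⱼ} = 0` for every `x ∈ [0,1]ᴺ`, then `g = 0`. (Peel off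
the first variable: for fixed `x'` the inner sums `G_k(x') = Σ_{b'} g(k ∷ b') x'^{b'}` form an
absolutely summable family with `Σ_k G_k(x') tᵏ = 0` on `[0,1]`, so they vanish by the one-variable
case; induct on `N`.) [folklore] -/
private theorem eq_zero_of_tsum_mul_prod_pow_eq_zero_loc :
    ∀ (N : ℕ) (g : (Fin N → ℕ) → ℂ), Summable (fun b => ‖g b‖) →
      (∀ x : Fin N → ℝ, (∀ j, x j ∈ Icc (0:ℝ) 1) →
        ∑' b, g b * ∏ j, ((x j : ℝ) : ℂ) ^ (b j) = 0) →
      ∀ b, g b = 0 := by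
  intro N
  induction N with
  | zero =>
    intro g _ h b
    have h0 := h (fun j => j.elim0) (fun j => j.elim0)
    rw [tsum_eq_single b] at h0
    · simpa using h0
    · intro b' hb'
      exact absurd (Subsingleton.elim b' b) hb'
  | succ N ih =>
    intro g hg h b
    set e : ℕ × (Fin N → ℕ) ≃ (Fin (N + 1) → ℕ) := Fin.consEquiv (fun _ => ℕ) with he
    have hg' : Summable fun p : ℕ × (Fin N → ℕ) => ‖g (Fin.cons p.1 p.2)‖ :=
      (e.summable_iff (f := fun b => ‖g b‖)).2 hg
    have hgk : ∀ k : ℕ, Summable fun b' : Fin N → ℕ => ‖g (Fin.cons k b')‖ := fun k =>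
      hg'.prod_factor k
    -- the inner sums vanish on the cube
    have hinner : ∀ k : ℕ, ∀ x' : Fin N → ℝ, (∀ j, x' j ∈ Icc (0:ℝ) 1) →
        ∑' b', g (Fin.cons k b') * ∏ j, ((x' j : ℝ) : ℂ) ^ (b' j) = 0 := by
      intro k x' hx'
      -- the family `k ↦ G_k(x')`
      have hGbd : ∀ k, ‖∑' b', g (Fin.cons k b') * ∏ j, ((x' j : ℝ) : ℂ) ^ (b' j)‖ ≤
          ∑' b', ‖g (Fin.cons k b')‖ := fun k => by
        refine (norm_tsum_le_tsum_norm ?_).trans (Summable.tsum_le_tsum (fun b' => ?_) ?_ (hgk k))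
        · exact (hgk k).of_nonneg_of_le (fun _ => norm_nonneg _) fun b' => by
            rw [norm_mul]
            exact mul_le_of_le_one_right (norm_nonneg _) (norm_prod_ofReal_pow_le_one_loc x' hx' b')
        · rw [norm_mul]
          exact mul_le_of_le_one_right (norm_nonneg _) (norm_prod_ofReal_pow_le_one_loc x' hx' b')
        · exact (hgk k).of_nonneg_of_le (fun _ => norm_nonneg _) fun b' => by
            rw [norm_mul]
            exact mul_le_of_le_one_right (norm_nonneg _) (norm_prod_ofReal_pow_le_one_loc x' hx' b')
      have hGsum : Summable fun k =>
          ‖∑' b', g (Fin.cons k b') * ∏ j, ((x' j : ℝ) : ℂ) ^ (b' j)‖ :=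
        (hg'.prod).of_nonneg_of_le (fun _ => norm_nonneg _) hGbd
      refine eq_zero_of_tsum_mul_pow_eq_zero_loc _ hGsum (fun t ht => ?_) k
      -- evaluate the full series at `t ∷ x'`
      have hx : ∀ j, (Fin.cons t x' : Fin (N + 1) → ℝ) j ∈ Icc (0:ℝ) 1 := fun j =>
        Fin.cases (by simpa using ht) (fun i => by simpa using hx' i) j
      have h1 := h (Fin.cons t x') hx
      rw [← e.tsum_eq] at h1
      have he' : ∀ p : ℕ × (Fin N → ℕ), e p = Fin.cons p.1 p.2 := fun p => rfl
      have hmono : ∀ p : ℕ × (Fin N → ℕ),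
          g (e p) * ∏ j, (((Fin.cons t x' : Fin (N + 1) → ℝ) j : ℝ) : ℂ) ^ (e p j) =
            g (Fin.cons p.1 p.2) * (∏ j, ((x' j : ℝ) : ℂ) ^ (p.2 j)) * (t : ℂ) ^ p.1 := by
        intro p
        rw [he', Fin.prod_univ_succ]
        simp only [Fin.cons_zero, Fin.cons_succ]
        ring
      simp only [hmono] at h1
      have hsum2 : Summable fun p : ℕ × (Fin N → ℕ) =>
          g (Fin.cons p.1 p.2) * (∏ j, ((x' j : ℝ) : ℂ) ^ (p.2 j)) * (t : ℂ) ^ p.1 := by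
        refine Summable.of_norm_bounded hg' fun p => ?_
        rw [norm_mul, norm_mul, mul_assoc]
        refine mul_le_of_le_one_right (norm_nonneg _)
          (mul_le_one₀ (norm_prod_ofReal_pow_le_one_loc x' hx' p.2) (norm_nonneg _) ?_)
        rw [norm_pow, Complex.norm_real, Real.norm_of_nonneg ht.1]
        exact pow_le_one₀ ht.1 ht.2
      rw [hsum2.tsum_prod] at h1
      rw [← h1]
      refine tsum_congr fun k => ?_
      rw [← tsum_mul_right]
    -- conclude by the induction hypothesis on each slice
    have hslice : ∀ k : ℕ, ∀ b', g (Fin.cons k b') = 0 := fun k =>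
      ih (fun b' => g (Fin.cons k b')) (hgk k) (hinner k)
    rw [← Fin.cons_self_tail b]
    exact hslice (b 0) (Fin.tail b)

/-! ## Algebraicity of the series over `ℚ̄(z)` -/

/-- **Identity theorem, transferred to `ℂ[[z₀, z₁, …]]`**: a series with absolutely summable
coefficients depending only on `z₀, …, z_{N-1}` whose value vanishes at (the point attached to)
every `x ∈ [0,1]ᴺ` is zero. [folklore] -/
theorem eq_zero_of_eval_cube_eq_zero {N : ℕ} (G : AyoubRel.CSeries)
    (hGs : Summable fun b : ℕ →₀ ℕ => ‖MvPowerSeries.coeff b G‖)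
    (hGd : AyoubRel.DependsOnlyOnLT G N)
    (hGev : ∀ x : Fin N → ℝ, (∀ j, x j ∈ Set.Icc (0:ℝ) 1) →
      ∑' b : ℕ →₀ ℕ, MvPowerSeries.coeff b G *
        b.prod (fun i e => (fun i : ℕ => if hi : i < N then ((x ⟨i, hi⟩ : ℝ) : ℂ) else 0) i ^ e)
          = 0) :
    G = 0 := by
  classical
  set e := (Finsupp.equivFunOnFinite : (Fin N →₀ ℕ) ≃ (Fin N → ℕ)) with he
  set g : (Fin N → ℕ) → ℂ :=
    fun a => MvPowerSeries.coeff (Finsupp.embDomain Fin.valEmbedding (e.symm a)) G with hg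
  have hinj : Function.Injective
      (fun a : Fin N → ℕ => Finsupp.embDomain (M := ℕ) (Fin.valEmbedding (n := N)) (e.symm a)) :=
    (Finsupp.embDomain_injective _).comp e.symm.injective
  have hgs : Summable fun a => ‖g a‖ := hGs.comp_injective hinj
  have hval : ∀ x : Fin N → ℝ, (∀ j, x j ∈ Set.Icc (0:ℝ) 1) →
      ∑' a, g a * ∏ j, ((x j : ℝ) : ℂ) ^ (a j) = 0 := by
    intro x hx
    rw [← hGev x hx, ← hinj.tsum_eq]
    · refine tsum_congr fun a => ?_
      rw [hg, prod_pow_embDomain_cubePt]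
      simp [he]
    · intro b hb
      rw [Function.mem_support] at hb
      have hb' : b ∈ Set.range (Finsupp.embDomain (M := ℕ) (Fin.valEmbedding (n := N))) := by
        by_contra hb'
        exact hb (by rw [hGd b (exists_of_not_mem_range_embDomain hb'), zero_mul])
      obtain ⟨a', rfl⟩ := hb'
      exact ⟨e a', by simp [he]⟩
  have hg0 := eq_zero_of_tsum_mul_prod_pow_eq_zero_loc N g hgs hval
  ext b
  rw [map_zero]
  by_cases hb : b ∈ Set.range (Finsupp.embDomain (M := ℕ) (Fin.valEmbedding (n := N)))
  · obtain ⟨a', rfl⟩ := hb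
    have := hg0 (e a')
    simpa [hg, he] using this
  · exact hGd b (exists_of_not_mem_range_embDomain hb)

/-- **Algebraicity over `ℚ̄(z)`.** If `F` has absolutely summable coefficients, depends only on
`z₀, …, z_{N-1}`, evaluates on the cube to `h`, and `h` satisfies `Σᵢ qᵢ(x) h(x)ⁱ = 0` on the cube
with `(qᵢ) ≠ 0` in `ℚ[x][y]`, then `F` is a root of the non-zero polynomial `Σᵢ qᵢ Yⁱ` pushed into
`ℚ̄[z][Y]`: the composite series vanishes on the cube, hence is `0` by the identity theorem.
[cite: Ayoub2014, Def. 9 and Rem. 13] -/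
theorem isAlgebraicOverRatFunc_of_identity {N : ℕ} (h : (Fin N → ℝ) → ℝ)
    (c : (Fin N →₀ ℕ) → ℝ) (F : AyoubRel.CSeries)
    (hFc : ∀ a : Fin N →₀ ℕ, MvPowerSeries.coeff (a.embDomain Fin.valEmbedding) F = (c a : ℂ))
    (hFz : ∀ b : ℕ →₀ ℕ, b ∉ Set.range (Finsupp.embDomain (Fin.valEmbedding (n := N))) →
      MvPowerSeries.coeff b F = 0)
    (hFs : Summable fun b : ℕ →₀ ℕ => ‖MvPowerSeries.coeff b F‖)
    (hsum : ∀ x : Fin N → ℝ, (∀ j, x j ∈ Set.Icc (0:ℝ) 1) →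
      HasSum (fun a : Fin N →₀ ℕ => c a * ∏ j, x j ^ a j) (h x))
    (Q₁ : Polynomial (MvPolynomial (Fin N) ℚ)) (hQ₁ : Q₁ ≠ 0)
    (hQh : ∀ x : Fin N → ℝ, (∀ j, x j ∈ Set.Icc (0:ℝ) 1) →
      ∑ i ∈ Finset.range (Q₁.natDegree + 1), MvPolynomial.aeval x (Q₁.coeff i) * h x ^ i = 0) :
    AyoubRel.IsAlgebraicOverRatFunc (algebraMap (algebraicClosure ℚ ℂ) ℂ) F := by
  classical
  set k₀ := algebraicClosure ℚ ℂ with hk₀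
  set σ₀ : k₀ →+* ℂ := algebraMap k₀ ℂ with hσ₀
  set φ : MvPolynomial (Fin N) ℚ →+* MvPolynomial ℕ k₀ :=
    (MvPolynomial.rename (Fin.val : Fin N → ℕ) :
        MvPolynomial (Fin N) k₀ →ₐ[k₀] MvPolynomial ℕ k₀).toRingHom.comp
      (MvPolynomial.map (algebraMap ℚ k₀)) with hφ
  have hφapp : ∀ r, φ r = MvPolynomial.rename Fin.val (MvPolynomial.map (algebraMap ℚ k₀) r) :=
    fun r => rfl
  have hφinj : Function.Injective φ := by
    intro r s hrs
    rw [hφapp, hφapp] at hrs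
    exact MvPolynomial.map_injective _ (algebraMap ℚ k₀).injective
      (MvPolynomial.rename_injective _ Fin.val_injective hrs)
  -- the coefficients, pushed into `ℂ[z₀, z₁, …]`
  set q : ℕ → MvPolynomial ℕ ℂ := fun i =>
    MvPolynomial.rename Fin.val (MvPolynomial.map (algebraMap ℚ ℂ) (Q₁.coeff i)) with hq
  have hpoly : ∀ r : MvPolynomial (Fin N) ℚ, AyoubRel.polyToCSeries σ₀ (φ r) =
      ((MvPolynomial.rename Fin.val (MvPolynomial.map (algebraMap ℚ ℂ) r) : MvPolynomial ℕ ℂ) :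
        AyoubRel.CSeries) := by
    intro r
    simp only [AyoubRel.polyToCSeries, RingHom.comp_apply,
      MvPolynomial.coeToMvPowerSeries.ringHom_apply, hφapp]
    rw [MvPolynomial.map_rename, MvPolynomial.map_map]
    congr
  set G : AyoubRel.CSeries :=
    ∑ i ∈ Finset.range (Q₁.natDegree + 1), ((q i : MvPolynomial ℕ ℂ) : AyoubRel.CSeries) * F ^ i
    with hGdef
  have hG : Polynomial.eval₂ (AyoubRel.polyToCSeries σ₀) F (Q₁.map φ) = G := by
    rw [hGdef, Polynomial.eval₂_map, Polynomial.eval₂_eq_sum_range]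
    refine Finset.sum_congr rfl fun i _ => ?_
    rw [RingHom.comp_apply, hpoly (Q₁.coeff i)]
  refine ⟨Q₁.map φ, (Polynomial.map_ne_zero_iff hφinj).2 hQ₁, ?_⟩
  rw [hG]
  -- `G` vanishes on the cube
  have hGs : Summable fun b : ℕ →₀ ℕ => ‖MvPowerSeries.coeff b G‖ :=
    summable_norm_coeff_polyComb _ q hFs
  have hGd : AyoubRel.DependsOnlyOnLT G N :=
    dependsOnlyOnLT_polyComb _ (fun i => MvPolynomial.map (algebraMap ℚ ℂ) (Q₁.coeff i))
      (dependsOnlyOnLT_of_coeff hFz)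
  refine eq_zero_of_eval_cube_eq_zero G hGs hGd fun x hx => ?_
  have hy := norm_cubePt_le_one x hx
  rw [hGdef, tsum_coeff_polyComb_mul_prod_pow hy _ q hFs,
    (hasSum_eval_of_coeff hFc hFz x (hsum x hx)).tsum_eq]
  have hqi : ∀ i, MvPolynomial.eval (fun i : ℕ => if hi : i < N then ((x ⟨i, hi⟩ : ℝ) : ℂ) else 0)
      (q i) = ((MvPolynomial.aeval x (Q₁.coeff i) : ℝ) : ℂ) := by
    intro i
    rw [hq]
    simp only
    rw [MvPolynomial.eval_rename, MvPolynomial.eval_map, ofReal_aeval_eq]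
    congr 1
    funext j
    simp only [Function.comp_apply, dif_pos j.is_lt, Fin.eta]
  simp only [hqi]
  have := congrArg (fun r : ℝ => (r : ℂ)) (hQh x hx)
  push_cast at this
  exact this

/-! ## The stub -/

/-- STUB (D) dictionary, analytic half: the real germ `Σₐ cₐ xᵃ` (polyradius `> 1`, sum `h`
`ℚ`-semialgebraic near the closed cube) is, read as a complex power series `F` in the variables
`z₀, …, z_{N−1}` of `ℂ[[z₀, z₁, …]]`, an element of Ayoub's `𝒪_{ℚ̄-alg}(𝔻̄^∞)` for the embedding of
`ℚ̄ = algebraicClosure ℚ ℂ` (depends on finitely many variables; polyradius `> 1`; ALGEBRAIC over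
`ℚ̄(z)`: a semialgebraic function satisfies a non-trivial polynomial identity `P(x, h x) = 0`, which
passes to the series by the identity theorem on the cube), and its cube integral `intC F`
(`Σₐ cₐ ∏ᵢ (aᵢ+1)⁻¹`) is `∫_{[0,1]ᴺ} h` (termwise integration of an absolutely convergent series).
[cite: Ayoub2014, Def. 9 and Rem. 13] -/
theorem stub_germToOan :
    ∀ (N : ℕ) (h : (Fin N → ℝ) → ℝ) (V : Set (Fin N → ℝ)) (c : (Fin N →₀ ℕ) → ℝ) (R : ℝ),
      IsOpen V → Set.pi Set.univ (fun _ : Fin N => Set.Icc (0:ℝ) 1) ⊆ V →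
      IsSemialgebraicFunOn ℚ V h → 1 < R →
      Summable (fun a : Fin N →₀ ℕ => |c a| * R ^ a.degree) →
      (∀ x ∈ Set.pi Set.univ (fun _ : Fin N => Set.Icc (0:ℝ) 1),
        HasSum (fun a : Fin N →₀ ℕ => c a * ∏ j, x j ^ a j) (h x)) →
      ∃ F : AyoubRel.CSeries,
        (∀ a : Fin N →₀ ℕ, MvPowerSeries.coeff (a.embDomain Fin.valEmbedding) F = (c a : ℂ)) ∧
        (∀ b : ℕ →₀ ℕ, b ∉ Set.range (Finsupp.embDomain (Fin.valEmbedding (n := N))) →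
          MvPowerSeries.coeff b F = 0) ∧
        F ∈ AyoubRel.Oan (algebraMap (algebraicClosure ℚ ℂ) ℂ) ∧
        AyoubRel.intC F = ((∫ x in Set.pi Set.univ (fun _ : Fin N => Set.Icc (0:ℝ) 1), h x : ℝ) : ℂ) := by
  intro N h V c R _ hVsub hh hR hsum hHas
  obtain ⟨F, hFc, hFz⟩ := exists_series_of_coeff N c
  have hcube : ∀ x : Fin N → ℝ, (∀ j, x j ∈ Set.Icc (0:ℝ) 1) →
      x ∈ Set.pi Set.univ (fun _ : Fin N => Set.Icc (0:ℝ) 1) := fun x hx =>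
    Set.mem_univ_pi.2 hx
  have hFw := summable_weighted_of_coeff hFc hFz hsum
  have hFs : Summable fun b : ℕ →₀ ℕ => ‖MvPowerSeries.coeff b F‖ :=
    AyoubRel.summable_norm_coeff_of_hasPolyradiusGtOne ⟨R, hR, hFw⟩
  obtain ⟨Q₁, hQ₁, hQh⟩ := exists_polynomial_identity hh
  refine ⟨F, hFc, hFz, ⟨⟨N, dependsOnlyOnLT_of_coeff hFz⟩, ⟨R, hR, hFw⟩, ?_⟩, ?_⟩
  · exact isAlgebraicOverRatFunc_of_identity h c F hFc hFz hFs
      (fun x hx => hHas x (hcube x hx)) Q₁ hQ₁ (fun x hx => hQh x (hVsub (hcube x hx)))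
  · rw [intC_eq_of_coeff hFc hFz, integral_cube_eq_tsum hR hsum hHas, Complex.ofReal_tsum]
    push_cast
    rfl


/-- **Registered form** `stub_germToOanFull` of the stub `stub_germToOan`: the SAME statement, the
implicit dimension of `Fin.valEmbedding` being passed as `@Fin.valEmbedding N` instead of by the
named-argument syntax (whose assignment token truncates the skeleton-registered signature of
`stub_germToOan` on the ledger). [cite: Ayoub2014, Def. 9 and Rem. 13] -/
theorem stub_germToOanFull :
    ∀ (N : ℕ) (h : (Fin N → ℝ) → ℝ) (V : Set (Fin N → ℝ)) (c : (Fin N →₀ ℕ) → ℝ) (R : ℝ),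
      IsOpen V → Set.pi Set.univ (fun _ : Fin N => Set.Icc (0:ℝ) 1) ⊆ V →
      IsSemialgebraicFunOn ℚ V h → 1 < R →
      Summable (fun a : Fin N →₀ ℕ => |c a| * R ^ a.degree) →
      (∀ x ∈ Set.pi Set.univ (fun _ : Fin N => Set.Icc (0:ℝ) 1),
        HasSum (fun a : Fin N →₀ ℕ => c a * ∏ j, x j ^ a j) (h x)) →
      ∃ F : AyoubRel.CSeries,
        (∀ a : Fin N →₀ ℕ, MvPowerSeries.coeff (a.embDomain Fin.valEmbedding) F = (c a : ℂ)) ∧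
        (∀ b : ℕ →₀ ℕ, b ∉ Set.range (Finsupp.embDomain (@Fin.valEmbedding N)) →
          MvPowerSeries.coeff b F = 0) ∧
        F ∈ AyoubRel.Oan (algebraMap (algebraicClosure ℚ ℂ) ℂ) ∧
        AyoubRel.intC F = ((∫ x in Set.pi Set.univ (fun _ : Fin N => Set.Icc (0:ℝ) 1), h x : ℝ) : ℂ) :=
  stub_germToOan

end Summit.KontsevichZagierPeriods.KontsevichZagierPeriods.StokesGenerationLine
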